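import Literature.NumberTheory.GelbartRogawski1991.LocalDoubledUnitarySplittingDataSplit
import Literature.NumberTheory.GelbartRogawski1991.LocalKudlaSplittingRigiditySplit
import Literature.NumberTheory.GelbartRogawski1991.LocalSplittingsDifferByCharacter
import HarnessLib

/-!
# Kudla's split-place splitting does not depend on the choice of the place above `v`
# ([Kudla1994, Thm 3.1]; [HarrisKudlaSweet1996, §1 (1.15)–(1.16)])

Topic `NumberTheory/GelbartRogawski1991`; namespace
`Literature.NumberTheory.GelbartRogawski1991.UnitaryDualPair.LocalSplitting`. KERNEL ONLY: theorems; no definition,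
no named fact, no `sorry`.

At a finite place `v` of `F` split in `E` there are TWO places `w`, `c⁻¹ • w` of `E` above `v`, and the split datum
`localSplittingDatumSplit … w hw χv …` of the doubled group `H = U(𝕍 ⊕ −𝕍)` ([Kudla1994, Thm 3.1]:
`β_w(g) = λ_{m_w}(ι g) · χ_w(det g_w)`, `m_w` the `ι(H)`-stable Lagrangian attached to `w`) is built from a CHOICE of
one of them. MAIN RESULT (`localSplitting_localSplittingDatumSplit_eq`): for a split pair `χv`
(`IsSplitPair` at both places) **the two data have the SAME local splitting** `s : H(F_v) →* S̃p(𝕎^𝔻_v)`, hence the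
same Weil representation (`localOmega_localSplittingDatumSplit_eq`). PROOF (rigidity, as in
`LocalDoubledUnitarySplitMixedModel`): both splittings lie over `ι^𝔻_v` (`proj_localSplitting`), so they differ by
a character `η` of `H(F_v)` (`MpPsi.exists_character_of_proj_eq`); they share Rao's section `r_Δ` (the `L0` datum) and
on the Siegel parabolic `P_Δ` both splitting functions equal `χ_v(det_Δ ·)` (`L1s_parabolic`, a product over BOTH
places), so `η = 1` on `P_Δ`, hence `η = 1` (`eq_one_of_forall_isSiegelDelta_eq_one_of_split`; `T₀` diagonal, `0 < n`).

Use (cell `hodgecm-mathlib`, d6 card S4): the CM package `localSplittingDatumCM θ` picks `w₀ := h.choose`; with this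
file the explicit split-place model `LocalUnitaryUndoublingSplitMixedModel` may be read at EITHER place above `v`.
Nothing here is a claim of [Liu2021].

## References

* S. S. Kudla, Israel J. Math. 87 (1994) 361–401, §3, Thm 3.1 [Kudla1994].
* M. Harris, S. S. Kudla, W. J. Sweet, J. Amer. Math. Soc. 9 (1996), §1 (1.15)–(1.16) [HarrisKudlaSweet1996].
* C. Mœglin, M.-F. Vignéras, J.-L. Waldspurger, LNM 1291 (1987), Chap. 2 II.1 (B) [MoeglinVignerasWaldspurger1987].
-/

set_option autoImplicit false

noncomputable section

open NumberField IsDedekindDomain MeasureTheory Matrix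
open Literature.RepresentationTheory.HeisenbergGroup
open Literature.NumberTheory.Automorphic Literature.NumberTheory.Automorphic.UnitaryGroup Literature.NumberTheory.Weil1964

namespace Literature.NumberTheory.GelbartRogawski1991.UnitaryDualPair.LocalSplitting

variable (F : Type) [Field F] [NumberField F] (E : Type) [Field E] [NumberField E] [Algebra F E]
  [Algebra.IsQuadraticExtension F E] (c : E ≃ₐ[F] E)
  {δ : E} (hcδ : c δ = -δ) (hδ : δ ≠ 0) {d : F} (hd : δ * δ = algebraMap F E d)
  (v : HeightOneSpectrum (𝓞 F))
  [MeasurableSpace (v.adicCompletion F)] [BorelSpace (v.adicCompletion F)]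
  (μ : Measure (v.adicCompletion F)) [μ.IsAddHaarMeasure]
  (n : ℕ) {T₀ : Matrix (Fin n) (Fin n) F} (hT₀ : T₀.IsSymm) (hT₀d : IsUnit T₀.det)
  {JD : Matrix (Fin (n + n)) (Fin (n + n)) E} (hJD : JD = (gramD F n T₀).map (algebraMap F E))

/-- **the local splitting of the split datum, unfolded**: `s(g) = i(β(g))⁻¹ · r_Δ(ι g)` with
`β = betaSplitDoubled … w` and `r_Δ` the `L0` section at `ℓ_Δ` (definitional). [cite: Kudla1994, Thm 3.1] -/
theorem localSplitting_localSplittingDatumSplit_apply (w : PlacesOver E v) (hw : c • w.1 ≠ w.1)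
    (χv : ∀ w : PlacesOver E v, (w.1.adicCompletion E)ˣ →* ℂˣ) (hχ1 : IsTrivialNearOne F E v w (χv w))
    (g : UnitaryGroup.localPi E c (n + n) JD v) :
    (localSplittingDatumSplit F E c hcδ hδ hd v μ n hT₀ hT₀d hJD w hw χv hχ1).localSplitting g =
      MpPsi.ofScalar _ (betaSplitDoubled F E c hcδ hδ hd v μ n hT₀ hT₀d hJD w hw (L0D F v μ n hT₀d).hψ' χv g)⁻¹ *
        (L0D F v μ n hT₀d).r.secMpPsi (iotaD F E c hcδ hδ hd v n hT₀ hJD g) :=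
  rfl

/-- **on `P_Δ` the splitting of the split datum is `i(χ_v(det_Δ p))⁻¹ · r_Δ(ι p)`** — independent of the
chosen place `w` (`L1s_parabolic`; `χ_v(det_Δ ·)` is a product over BOTH places above `v`).
[cite: Kudla1994, Thm 3.1; HarrisKudlaSweet1996, §1 (1.15)–(1.16)] -/
theorem localSplitting_localSplittingDatumSplit_apply_of_isSiegelDelta (w : PlacesOver E v) (hw : c • w.1 ≠ w.1)
    (χv : ∀ w : PlacesOver E v, (w.1.adicCompletion E)ˣ →* ℂˣ) (hχ : IsSplitPair F E c v w χv)
    (hχ1 : IsTrivialNearOne F E v w (χv w)) (p : UnitaryGroup.localPi E c (n + n) JD v)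
    (hp : IsSiegelDelta F E c hcδ hδ hd v n hT₀ hJD p) :
    (localSplittingDatumSplit F E c hcδ hδ hd v μ n hT₀ hT₀d hJD w hw χv hχ1).localSplitting p =
      MpPsi.ofScalar _ (chiDet F E c v n χv p)⁻¹ * (L0D F v μ n hT₀d).r.secMpPsi (iotaD F E c hcδ hδ hd v n hT₀ hJD p) := by
  rw [localSplitting_localSplittingDatumSplit_apply,
    L1s_parabolic F E c hcδ hδ hd v μ n hT₀ hT₀d hJD w hw (L0D F v μ n hT₀d).hψ' χv hχ p hp]

/-- **RIGIDITY: two local splitting data of the doubled group that agree on `P_Δ` have the same splitting**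
(`T₀` diagonal, `0 < n`, `v` split): both splittings lie over `ι^𝔻_v`, so they differ by a character of `H(F_v)`
(`MpPsi.exists_character_of_proj_eq`), trivial on `P_Δ` by hypothesis, hence trivial
(`eq_one_of_forall_isSiegelDelta_eq_one_of_split`). [cite: Kudla1994, Thm 3.1; MoeglinVignerasWaldspurger1987, Chap. 2 II.1 (B)] -/
theorem LocalSplittingDatum.localSplitting_eq_of_forall_isSiegelDelta (w : PlacesOver E v) (hw : c • w.1 ≠ w.1)
    (hn : 0 < n) (t : Fin n → F) (hT₀t : T₀ = Matrix.diagonal t)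
    (D₁ D₂ : LocalSplittingDatum F E c (n + n) hcδ hδ hd (gramD F n T₀) (gramD_isSymm F n hT₀) (isUnit_det_gramD F n hT₀d)
      hJD v μ (deltaLagrangian F v n) (deltaLagrangian_orthogonal F v n T₀ hT₀d))
    (h : ∀ p, IsSiegelDelta F E c hcδ hδ hd v n hT₀ hJD p → D₁.localSplitting p = D₂.localSplitting p) :
    D₁.localSplitting = D₂.localSplitting := by
  haveI : Nontrivial (SchwartzBruhat (Fin (n + n) → v.adicCompletion F)) := nontrivial_schwartzBruhat_pi
  -- the two splittings differ by a character `η` of `H(F_v)`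
  obtain ⟨η, hη⟩ := MpPsi.exists_character_of_proj_eq (localSchrodinger F (n + n) (gramD F n T₀) v) D₁.hU
    D₁.localSplitting D₂.localSplitting fun g => by rw [D₂.proj_localSplitting, D₁.proj_localSplitting]
  -- `η = 1` on `P_Δ`, hence everywhere
  have hη1 : η = 1 :=
    eq_one_of_forall_isSiegelDelta_eq_one_of_split F E c hcδ hδ hd v n hn t hT₀t hT₀ hT₀d hJD w hw η fun p hp =>
      MpPsi.ofScalar_injective (localSchrodinger F (n + n) (gramD F n T₀) v)
        ((mul_eq_right.1 ((hη p).symm.trans (h p hp).symm)).trans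
          (map_one (MpPsi.ofScalar (localSchrodinger F (n + n) (gramD F n T₀) v))).symm)
  refine MonoidHom.ext fun g => ?_
  have hηg : MpPsi.ofScalar (localSchrodinger F (n + n) (gramD F n T₀) v) (η g) = 1 := by
    rw [hη1, MonoidHom.one_apply, map_one]
  exact ((hη g).trans ((congrArg (· * D₁.localSplitting g) hηg).trans (one_mul _))).symm

/-- **KUDLA'S SPLIT-PLACE SPLITTING DOES NOT DEPEND ON THE CHOICE OF THE PLACE ABOVE `v`**: for two places
`w, w'` of `E` above a split `v` (e.g. `w' = c⁻¹ • w`), a split pair `χv` (`IsSplitPair` at `w` and at `w'`, trivial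
near `1` at both), `T₀` diagonal and `0 < n`, the data `localSplittingDatumSplit … w …` and `localSplittingDatumSplit … w' …`
of the doubled group have the SAME local splitting `H(F_v) →* S̃p_{ψ_v}(𝕎^𝔻_v)`.
[cite: Kudla1994, Thm 3.1; HarrisKudlaSweet1996, §1 (1.15)–(1.16); MoeglinVignerasWaldspurger1987, Chap. 2 II.1 (B)] -/
theorem localSplitting_localSplittingDatumSplit_eq (w w' : PlacesOver E v) (hw : c • w.1 ≠ w.1)
    (hw' : c • w'.1 ≠ w'.1) (χv : ∀ w : PlacesOver E v, (w.1.adicCompletion E)ˣ →* ℂˣ)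
    (hχ : IsSplitPair F E c v w χv) (hχ' : IsSplitPair F E c v w' χv) (hχ1 : IsTrivialNearOne F E v w (χv w))
    (hχ1' : IsTrivialNearOne F E v w' (χv w')) (hn : 0 < n) (t : Fin n → F) (hT₀t : T₀ = Matrix.diagonal t) :
    (localSplittingDatumSplit F E c hcδ hδ hd v μ n hT₀ hT₀d hJD w hw χv hχ1).localSplitting =
      (localSplittingDatumSplit F E c hcδ hδ hd v μ n hT₀ hT₀d hJD w' hw' χv hχ1').localSplitting :=
  LocalSplittingDatum.localSplitting_eq_of_forall_isSiegelDelta F E c hcδ hδ hd v μ n hT₀ hT₀d hJD w hw hn t hT₀t _ _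
    fun p hp =>
      (localSplitting_localSplittingDatumSplit_apply_of_isSiegelDelta F E c hcδ hδ hd v μ n hT₀ hT₀d hJD w hw χv hχ
          hχ1 p hp).trans
        (localSplitting_localSplittingDatumSplit_apply_of_isSiegelDelta F E c hcδ hδ hd v μ n hT₀ hT₀d hJD w' hw' χv
          hχ' hχ1' p hp).symm

/-- **hence the same local Weil representation** `ω_v = toRep ∘ s`. [cite: Kudla1994, Thm 3.1; HarrisKudlaSweet1996, §1 (1.16)] -/
theorem localOmega_localSplittingDatumSplit_eq (w w' : PlacesOver E v) (hw : c • w.1 ≠ w.1)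
    (hw' : c • w'.1 ≠ w'.1) (χv : ∀ w : PlacesOver E v, (w.1.adicCompletion E)ˣ →* ℂˣ)
    (hχ : IsSplitPair F E c v w χv) (hχ' : IsSplitPair F E c v w' χv) (hχ1 : IsTrivialNearOne F E v w (χv w))
    (hχ1' : IsTrivialNearOne F E v w' (χv w')) (hn : 0 < n) (t : Fin n → F) (hT₀t : T₀ = Matrix.diagonal t) :
    (localSplittingDatumSplit F E c hcδ hδ hd v μ n hT₀ hT₀d hJD w hw χv hχ1).localOmega =
      (localSplittingDatumSplit F E c hcδ hδ hd v μ n hT₀ hT₀d hJD w' hw' χv hχ1').localOmega :=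
  congrArg (fun s => (MpPsi.toRep (localSchrodinger F (n + n) (gramD F n T₀) v)).comp s)
    (localSplitting_localSplittingDatumSplit_eq F E c hcδ hδ hd v μ n hT₀ hT₀d hJD w w' hw hw' χv hχ hχ' hχ1 hχ1' hn t hT₀t)

end Literature.NumberTheory.GelbartRogawski1991.UnitaryDualPair.LocalSplitting

end
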